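import Literature.MathematicalPhysics.QuantumFieldTheory.BalabanImbrieJaffe1984to88.BIJ88Eq242HiggsCovarianceTorus
import Literature.MathematicalPhysics.QuantumFieldTheory.BalabanImbrieJaffe1984to88.BIJ88DeltaLocSmallPlaquetteTorusCwt

/-!
# `BalabanImbrieJaffe1984to88.BIJ88Eq242HiggsCovarianceTorusCwt` — T. Bałaban, J. Imbrie, A. Jaffe, *Effective action and cluster properties of
the abelian Higgs model*, Commun. Math. Phys. **114** (1988) 257–315 [BalabanImbrieJaffe1988], §2 pp. 264–265 [PDF 8–9], (2.40)–(2.47):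
**THE RANDOM WALK EXPANSION (2.42), ITS RESUMMATION (2.45) AND THE BOUNDS (2.41)/(2.46)/(2.47) FOR THE CONCRETE
`C^{(k)}_Λ(u) = [(Δ_{k,loc}(u) + (A/a_k)κ′P(u_k))|_Λ]^{−1}` OF GEN 15 (`BIJ88DeltaLoc234Torus.deltaLocT`), `Ω = T_η`, AT A GENERAL SMALL-PLAQUETTE
BACKGROUND, FOR THE PRINTED (2.27)/(2.29) TORUS DATA** — gen 23's `BIJ88Eq242HiggsCovarianceTorus` (p13's [6]-walk files `BIJ88Eq242Lattice` /
`BIJ88Ineq246Lattice` on the charted, realified torus operator) with its [6] (5.6) input DISCHARGED for the model's operator: the (2.38) member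
`ineq238_gen` and the (2.36) member `decay236_gen` of p31 g20's `BIJ88DeltaLocClose235General` on gen 22's torus inputs (`inputs_smallPlaquette`,
`rows_of_deep` of `BIJ88DeltaLocSmallPlaquetteTorusCwt`), and the chart distance of `T^{(k)}` identified with its torus distance on `Λ` (reference box
at most half the torus).

statement-level skeleton of published theorems with citation tags; proofs where landed; nothing here is a claim about the Yang–Mills mass gap

Print, p. 264: *"We define C^{(k)}_Λ(u) = [(Δ_{k,loc}(u) + aL^{−2}Q(u)*Q(u)|_Λ]^{−1}. (2.40) This is of course a nonlocal operator, but by (2.38),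
C^{(k)}_Λ(u)^{−1} is bounded below and a random walk expansion as in [6] can be used to prove that |C^{(k)}_Λ(u; x₁, x₂)| ≦ ce^{−c|x₁−x₂|}. (2.41) We
shall actually use a convenient resummation of this expansion. The basic expansion has the form C^{(k)}_Λ(u) = Σ_ω C^{(k)}_{Λ,ω}(u), (2.42) where ω is a
walk on a lattice of spacing M = O(1). … C^{(k)}_Λ(u) = C^{(k)}_{Λ,loc}(u) + Σ_X C^{(k)}_{Λ,X}(u), (2.45) … |C^{(k)}_{Λ,X}(u; x₁, x₂)| ≦ e^{−cr(e_k)|X|}.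
(2.46) … |C^{(k)}_{Λ,loc}(u; x₁, x₂) − C^{(k)}_Λ(u; x₁, x₂)| ≦ e^{−cr(e_k)}e^{−c|x₁−x₂|}. (2.47)"*; [6] = [Balaban1983RegularityDecay] (5.6) p. 594.

CONTENTS.
* §1 **`cdist_le_T_of_two_mul_abs_le`** / **`cdist_eq_T_of_two_mul_abs_le`**: for two sites of `T^{(j)}` whose coordinate representatives differ by
  at most half the period in every direction, gen 23's chart sup-distance `cdist` IS the torus sup-distance `B5Ineq137Torus.T` (p29's
  `le_circAbs_of_le_abs` + gen 23's `T_le_cdist`).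
* §2 **`two_mul_abs_sub_le_of_deep`**: two `k`-sites whose `L^k`-blocks lie in the reference box `Ω₀ = c·L^k + Π_i[0, L^kM₀_i)` of gen 22's data,
  the box at most half the torus (`2L^kM₀_i ≤ |T^{(0)}|`), are within half a period of `T^{(k)}`.
* §3 the constants **`E56`** (the (2.38) error of the row-restricted data), **`gamma56`** (`γ₅₆ = (A/a_k)(c240(γ₀,κ′)(1−σ) − E₅₆)`), **`c56`**
  (`c₅₆ = A(1 + m·a_kc₀e^{δ₀}) + (A/a_k)κ′L^{−2d′}e^{δ₀(L−1)}`), and **`hyp56_deltaLocT_gen`**: [6] (5.6) — `B4.Hyp56 Λ′ (reOp Λ (Δ_{k,loc}(u) +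
  (A/a_k)κ′P(u_k))) γ₅₆ c₅₆ δ₀` — AND invertibility of `(…)|_Λ` from p31 g20's row-restricted `_gen` inputs (torus-exterior depths, symmetric weights,
  cubes `k`-block unions, a small averaged field `u_k`) plus `cdist ≤ T` on `Λ × Λ`: `ineq238_gen` + `decay236_gen` BY NAME, fed to gen 23's
  `hyp56_op240_smallField` and gen 19's `isUnit_compress_op240_smallField`.
* §4 THE MEMBERS FOR THE PRINTED TORUS DATA (gen 22's binder list with the no-wrap condition `L^kM₀_i < |T|` strengthened to the half-torus condition
  `2L^kM₀_i ≤ |T|`): **`hyp56_deltaLocT_smallPlaquette_torus_cwt`** ((5.6) + invertibility: `0 < γ₅₆ ∧ 0 ≤ c₅₆ ∧ Hyp56 ∧ IsUnit`),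
  **`eq242_smallPlaquette_torus_cwt`** ((2.42): `C^{(k)}_Λ(u; x₁, x₂) = Σ_ω C^ℂ_ω(x₁, x₂)`, unconditional `HasSum` in `ℂ` over all walks),
  **`eq245_smallPlaquette_torus_cwt`** ((2.45), typed `BIJ88Sect2Statements.Eq245` for the realified entries), **`decay241_walk_smallPlaquette_torus_cwt`**
  ((2.41) by the printed walk route, torus distance), **`ineq246_smallPlaquette_torus_cwt`** ((2.46), typed `Ineq246`: support clause + one-constant
  bound `e^{−c·s·|X|}`), **`close247_smallPlaquette_torus_cwt`** ((2.47), typed `Close` IN THE TORUS DISTANCE `|x₁−x₂|_T/M`).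

HONEST SCOPE / DIVERGENCE.  (i) As gen 23's `BIJ88Eq242HiggsCovarianceTorus` (i)–(vi): real coordinates `Λ × {Re, Im}` of gen 18's realification
(plus the complex `HasSum` / norm forms of (2.42)/(2.41)); p13's walk data (cubes of `M` lattice units on the charted `Λ`, `r(e_k)`-cubes of `s` labels,
touching adjacency, label distance, `ρ`; constants `K_R`, `Θ₁`, `θ_W`, `K₀` at `N = 2`, taken at `(γ₅₆, c₅₆, δ₀)`); the walk-route (2.41) is the twin
of gen 22's Combes–Thomas `decay241_smallPlaquette_torus_cwt`; the u-locality clauses of (2.43)/(2.46) are not instantiated.  (ii) HALF-TORUS BOX: the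
reference box of the (2.27)/(2.29) data is assumed at most half the torus in every direction (`2L^kM₀_i ≤ |T^{(0)}|`, implying gen 22's `L^kM₀_i <
|T^{(0)}|`); then the chart distance equals the torus distance on `Λ` and (2.47) is displayed in the torus distance ((2.46)'s cube count and (2.45) are
distance-free).  (iii) `Ω = T_η` (gen 22's scope (ii)); `m = (⌊(L^k − 1 + R₀)/s_g⌋ + 3)^{d′}`; largeness `E₅₆ < c240(γ₀,κ′)(1−σ)` verbatim gen 22's.
(iv) Cube-size conditions `M ≥ 5`, `M > K_R`, `M > Θ₁`, `θ_W < 1`, `K₀ ≤ e^{cs}` are p13's, at the constants `(γ₅₆, c₅₆, δ₀)` of THIS operator (print: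
`M = O(1)`, `r(e_k) → ∞`).
Imports: gen 23 `BIJ88Eq242HiggsCovarianceTorus` (→ p13 `BIJ88Ineq246Lattice`, gen 19 `BIJ88Decay241SmallFieldTorus`), gen 22
`BIJ88DeltaLocSmallPlaquetteTorusCwt` (→ p31 g20 `BIJ88DeltaLocClose235General`, p29 `BIJ88LocWeights227Torus`, gen 15 `BIJ88DeltaLoc234Torus`).
Literature + Mathlib only.  Unit `lit-balaban-p31` (literature-prover-lit-balaban-p31-g23-0), 2026-08-23.  NOT summit progress.
-/

open scoped BigOperators Matrix ComplexConjugate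
open Finset Matrix

namespace Literature.MathematicalPhysics.QuantumFieldTheory.BalabanImbrieJaffe1984to88.BIJ88Eq242HiggsCovarianceTorusCwt

open Literature.MathematicalPhysics.QuantumFieldTheory.Balaban1983to89
open BIJ88Sect3Statements (U1 toC starB)
open BIJ85BlockAveragesTorus BIJ85BlockAveragesTorusK
open BIJ85BlockKPoincare (sitesPerDir_eq_mul_pow)
open BIJ88NeumannPropagator227Torus (gBox)
open BIJ88DeltaLoc234Torus (deltaLocT deltaLocT_conjTranspose)
open BIJ88NeumannPropagatorFlatDecayCube (cubeT boxCoord isBlockUnion_cubeT)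
open BIJ88Cutoffs21 (cutoff)
open BIJ88LocWeights227Torus (le_circAbs_of_le_abs cubeFam lamFam sum_abs_lamT_le_one cutoff_mem_unitInterval cubeFam_fits)
open BIJ88DeltaLocClose235General (decay236_gen ineq238_gen)
open BIJ88Close231RegularTorusCwt (deepRows)
open BIJ88Decay241RegularTorusCwt (lamFam_symm cutoff_T_symm)
open BIJ85AbelianStokes (plaqC)
open BIJ88NeumannNoZeroModesTorus (IsBlockUnion innerK isBlockUnion_univ)
open BIJ85Ineq732FlatRegion (starB_innerK_univ)
open BIJ88Eq240FlatTorus (realify compress op240 c240)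
open BIJ88Decay241FlatTorus (c240_smul)
open BIJ88Decay241SmallFieldTorus (isUnit_compress_op240_smallField)
open B4Sect5Proof (latticeConst)
open BIJ88DeltaLocSmallPlaquetteTorusCwt (inputs_smallPlaquette rows_of_deep)
open BIJ88RandomWalk242 BIJ88Eq242Lattice BIJ88Ineq246Lattice B4Sect5CubeBounds
open BIJ88Eq242HiggsCovarianceTorus
open B4TorusKernel.MultiPeriod (circAbs)

noncomputable section

variable {P : Params}

/-! ## §1 Inside a half-torus box the chart distance IS the torus distance -/

section HalfBox

variable {j : ℕ}

/-- **chart distance `≤` torus distance for pairs whose coordinate differences are at most half the period** (`2|x_μ.val − y_μ.val| ≤ N` in every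
direction ⇒ `dist(a, Nℤ) = |a|` coordinatewise; with `T_le_cdist` the two distances then agree) — p29's `le_circAbs_of_le_abs`.
[cite: BalabanImbrieJaffe1988, (2.41) p.264] -/
theorem cdist_le_T_of_two_mul_abs_le {x y : Balaban1983to89.Site P j}
    (h : ∀ μ, 2 * |((x μ).val : ℤ) - (y μ).val| ≤ (P.sitesPerDir j : ℤ)) : cdist x y ≤ B5Ineq137Torus.T P j x y := by
  have hN : 1 ≤ P.sitesPerDir j := (P.one_lt_sitesPerDir j).le
  refine cdist_le_of_forall (B5Ineq137Torus.T_nonneg P j x y) fun μ => ?_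
  set a : ℤ := ((x μ).val : ℤ) - (y μ).val with ha
  have hcast : ((|a| : ℤ) : ℝ) = |((x μ).val : ℝ) - (y μ).val| := by rw [ha]; push_cast; rfl
  have h2 : 2 * |((x μ).val : ℝ) - (y μ).val| ≤ P.sitesPerDir j := by
    have := (Int.cast_le (R := ℝ)).2 (h μ)
    push_cast at this
    exact this
  have h1 : |((x μ).val : ℝ) - (y μ).val| ≤ (circAbs (P.sitesPerDir j) a : ℝ) :=
    le_circAbs_of_le_abs hN (le_of_eq hcast.symm) (by rw [hcast]; linarith)
  have hcc := B4Sect5Torus.ccoord_cast (B5Ineq137Torus.Nv_pos P j) (B5Ineq137Torus.toT x) (B5Ineq137Torus.toT y) μ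
  have h3 : (circAbs (P.sitesPerDir j) a : ℝ) =
      ((B4Sect5Torus.ccoord (B5Ineq137Torus.Nv P j) (B5Ineq137Torus.toT x) (B5Ineq137Torus.toT y) μ : ℕ) : ℝ) := by
    have : (circAbs (P.sitesPerDir j) a : ℤ) =
        ((B4Sect5Torus.ccoord (B5Ineq137Torus.Nv P j) (B5Ineq137Torus.toT x) (B5Ineq137Torus.toT y) μ : ℕ) : ℤ) := by
      rw [hcc]; rfl
    exact_mod_cast this
  have h4 : ((B4Sect5Torus.ccoord (B5Ineq137Torus.Nv P j) (B5Ineq137Torus.toT x) (B5Ineq137Torus.toT y) μ : ℕ) : ℝ) ≤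
      B5Ineq137Torus.T P j x y := by
    unfold B5Ineq137Torus.T B4Sect5Torus.tdist
    exact_mod_cast Finset.le_sup (f := B4Sect5Torus.ccoord (B5Ineq137Torus.Nv P j) (B5Ineq137Torus.toT x) (B5Ineq137Torus.toT y))
      (mem_univ μ)
  linarith

/-- under the same half-period condition the chart distance EQUALS the torus distance. [cite: BalabanImbrieJaffe1988, (2.41) p.264] -/
theorem cdist_eq_T_of_two_mul_abs_le {x y : Balaban1983to89.Site P j}
    (h : ∀ μ, 2 * |((x μ).val : ℤ) - (y μ).val| ≤ (P.sitesPerDir j : ℤ)) : cdist x y = B5Ineq137Torus.T P j x y :=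
  le_antisymm (cdist_le_T_of_two_mul_abs_le h) (T_le_cdist x y)

end HalfBox

/-! ## §2 `k`-sites whose blocks lie in a reference box at most half the torus are pairwise within half a period -/

section DeepSites

variable {d : ℕ}

/-- **two `k`-sites whose `L^k`-blocks lie inside the reference box `Ω₀ = c·L^k + Π_i[0, L^kM₀_i)` (chart depth `≥ D ≥ 0`) have coordinate
differences `≤ M₀_μ − 1`; if the box is at most half the torus, `2L^kM₀_i ≤ |T^{(0)}|`, they are within half a period of `T^{(k)}`**, so the chart
distance of `T^{(k)}` agrees with its torus distance on such sites (`cdist_eq_T_of_two_mul_abs_le`). [cite: BalabanImbrieJaffe1988, (2.35) p.263] -/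
theorem two_mul_abs_sub_le_of_deep (hPd : P.d = d + 1) {k : ℕ} (hk : 0 + k ≤ P.m + P.K) {c M0 : Fin (d + 1) → ℕ} {D : ℝ} (hD : 0 ≤ D)
    (hhalf : ∀ i, 2 * (P.L ^ k * M0 i) ≤ P.sitesPerDir 0) {y₁ y₂ : Balaban1983to89.Site P (0 + k)}
    (h₁ : ∀ μ, (c (Fin.cast hPd μ) : ℝ) * P.L ^ k + D ≤ (P.L : ℝ) ^ k * (y₁ μ).val ∧
      (P.L : ℝ) ^ k * (y₁ μ).val + P.L ^ k + D ≤ (c (Fin.cast hPd μ) : ℝ) * P.L ^ k + (P.L : ℝ) ^ k * M0 (Fin.cast hPd μ))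
    (h₂ : ∀ μ, (c (Fin.cast hPd μ) : ℝ) * P.L ^ k + D ≤ (P.L : ℝ) ^ k * (y₂ μ).val ∧
      (P.L : ℝ) ^ k * (y₂ μ).val + P.L ^ k + D ≤ (c (Fin.cast hPd μ) : ℝ) * P.L ^ k + (P.L : ℝ) ^ k * M0 (Fin.cast hPd μ)) :
    ∀ μ, 2 * |((y₁ μ).val : ℤ) - (y₂ μ).val| ≤ (P.sitesPerDir (0 + k) : ℤ) := by
  intro μ
  have hPk : (0 : ℝ) < (P.L : ℝ) ^ k := pow_pos P.cast_L_pos k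
  obtain ⟨a1, b1⟩ := h₁ μ
  obtain ⟨a2, b2⟩ := h₂ μ
  -- the coordinates lie in `[c_μ, c_μ + M₀_μ − 1]`
  have lo1 : (c (Fin.cast hPd μ) : ℝ) ≤ (y₁ μ).val :=
    le_of_mul_le_mul_left (by linarith : (P.L : ℝ) ^ k * (c (Fin.cast hPd μ) : ℝ) ≤ (P.L : ℝ) ^ k * (y₁ μ).val) hPk
  have hi1 : ((y₁ μ).val : ℝ) + 1 ≤ (c (Fin.cast hPd μ) : ℝ) + M0 (Fin.cast hPd μ) :=
    le_of_mul_le_mul_left (by linarith : (P.L : ℝ) ^ k * (((y₁ μ).val : ℝ) + 1) ≤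
      (P.L : ℝ) ^ k * ((c (Fin.cast hPd μ) : ℝ) + M0 (Fin.cast hPd μ))) hPk
  have lo2 : (c (Fin.cast hPd μ) : ℝ) ≤ (y₂ μ).val :=
    le_of_mul_le_mul_left (by linarith : (P.L : ℝ) ^ k * (c (Fin.cast hPd μ) : ℝ) ≤ (P.L : ℝ) ^ k * (y₂ μ).val) hPk
  have hi2 : ((y₂ μ).val : ℝ) + 1 ≤ (c (Fin.cast hPd μ) : ℝ) + M0 (Fin.cast hPd μ) :=
    le_of_mul_le_mul_left (by linarith : (P.L : ℝ) ^ k * (((y₂ μ).val : ℝ) + 1) ≤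
      (P.L : ℝ) ^ k * ((c (Fin.cast hPd μ) : ℝ) + M0 (Fin.cast hPd μ))) hPk
  have hN : ((P.sitesPerDir 0 : ℕ) : ℝ) = (P.sitesPerDir (0 + k) : ℝ) * (P.L : ℝ) ^ k := by
    rw [sitesPerDir_eq_mul_pow hk]; push_cast; ring
  have hh : 2 * ((P.L : ℝ) ^ k * M0 (Fin.cast hPd μ)) ≤ (P.sitesPerDir (0 + k) : ℝ) * (P.L : ℝ) ^ k := by
    have := hhalf (Fin.cast hPd μ)
    have : ((2 * (P.L ^ k * M0 (Fin.cast hPd μ)) : ℕ) : ℝ) ≤ ((P.sitesPerDir 0 : ℕ) : ℝ) := by exact_mod_cast this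
    rw [hN] at this; push_cast at this; exact this
  have hM : 2 * (M0 (Fin.cast hPd μ) : ℝ) ≤ P.sitesPerDir (0 + k) :=
    le_of_mul_le_mul_left (by linarith : (P.L : ℝ) ^ k * (2 * (M0 (Fin.cast hPd μ) : ℝ)) ≤
      (P.L : ℝ) ^ k * (P.sitesPerDir (0 + k) : ℝ)) hPk
  have habs : |((y₁ μ).val : ℝ) - (y₂ μ).val| ≤ (M0 (Fin.cast hPd μ) : ℝ) - 1 := by
    rw [abs_le]; constructor <;> linarith
  have : (((2 * |((y₁ μ).val : ℤ) - (y₂ μ).val| : ℤ) : ℝ)) ≤ ((P.sitesPerDir (0 + k) : ℤ) : ℝ) := by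
    push_cast; linarith
  exact_mod_cast this

end DeepSites

/-! ## §3 [6] (5.6) FOR THE CONCRETE `(Δ_{k,loc}(u) + (A/a_k)κ′P(u_k))|_Λ` FROM THE ROW-RESTRICTED INPUTS — the `_gen` shape of p31 g20 -/

section Gen

/-- **the (2.38) error term of the row-restricted data** (p31 g20's `ineq238_gen`):
`E₅₆ = (4/3)d′⁴(L^{2k}θ)² + a_k²(c₀e^{δ₀/2}K_{d′}(δ₀/2))(m·e^{−2δ₀R/L^k} + e^{−(δ₀/2)R₁/L^k})` (`m` = labels active on a block).
[cite: BalabanImbrieJaffe1988, (2.38) p.264] -/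
def E56 (P : Params) (a : ℝ) (k : ℕ) (θ c₀ δ₀ : ℝ) (m : ℕ) (R R₁ : ℝ) : ℝ :=
  4 / 3 * (P.d : ℝ) ^ 4 * (((P.L : ℝ) ^ k) ^ 2 * θ) ^ 2 +
    B1.aSeq a P.L k ^ 2 * (c₀ * Real.exp (δ₀ / 2) * latticeConst P.d (δ₀ / 2)) *
      ((m : ℝ) * Real.exp (-(δ₀ * (((P.L : ℝ) ^ k)⁻¹ * (2 * R)))) + Real.exp (-(δ₀ / 2 * (((P.L : ℝ) ^ k)⁻¹ * R₁))))

/-- **the [6] (5.6) coercivity constant of `(Δ_{k,loc}(u) + (A/a_k)κ′P(u_k))|_Λ`**: `γ₅₆ = (A/a_k)(c240(γ₀, κ′)(1 − σ) − E₅₆)`,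
`γ₀ = min(a/(9(d′+1)), 1/12)`, `A = α_kL^{kd′}` (print's *"by (2.38), C^{(k)}_Λ(u)^{−1} is bounded below"*). [cite: BalabanImbrieJaffe1988, (2.40) p.264] -/
def gamma56 (P : Params) (a : ℝ) (k : ℕ) (θ c₀ δ₀ : ℝ) (m : ℕ) (R R₁ σ κ' : ℝ) : ℝ :=
  (B1RG242Torus.α P a k * (P.L : ℝ) ^ (k * P.d)) / B1.aSeq a P.L k *
    (c240 P (min (a / (9 * ((P.d : ℝ) + 1))) (1 / 12)) κ' * (1 - σ) - E56 P a k θ c₀ δ₀ m R R₁)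

/-- **the [6] (5.6) kernel constant of `(Δ_{k,loc}(u) + (A/a_k)κ′P(u_k))|_Λ`**: `c₅₆ = A(1 + m·a_kc₀e^{δ₀}) + (A/a_k)κ′L^{−2d′}e^{δ₀(L−1)}` (the
(2.36) constant of `decay236_gen` plus gen 19's bound on the averaging term). [cite: BalabanImbrieJaffe1988, (2.36) p.264] -/
def c56 (P : Params) (a : ℝ) (k : ℕ) (c₀ δ₀ : ℝ) (m : ℕ) (κ' : ℝ) : ℝ :=
  B1RG242Torus.α P a k * (P.L : ℝ) ^ (k * P.d) * (1 + m * B1.aSeq a P.L k * (c₀ * Real.exp δ₀)) +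
    (B1RG242Torus.α P a k * (P.L : ℝ) ^ (k * P.d)) / B1.aSeq a P.L k * κ' * (((P.L : ℝ) ^ P.d)⁻¹) ^ 2 * Real.exp (δ₀ * ((P.L : ℝ) - 1))

/-- **[6] (5.6) AND INVERTIBILITY FOR GEN 15's `(Δ_{k,loc}(u) + (A/a_k)κ′P(u_k))|_Λ` FROM THE ROW-RESTRICTED INPUTS WITH TORUS-EXTERIOR DEPTHS**
(the hypothesis list of p31 g20's `decay241_gen` minus its decay-rate conditions, plus: the chart distance of `T^{(k)}` is dominated by the torus
distance on `Λ × Λ` — true when `Λ` sits in a half-torus box, §2).  The (2.38)-shape bound is `ineq238_gen` (error `E₅₆`, `γ₀ = min(a/(9(d′+1)), 1/12)`),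
the (2.36)-shape bound is `decay236_gen` (`c_Δ = A(1 + m·a_kc₀e^{δ₀})`), both BY NAME; then gen 23's `hyp56_op240_smallField` and gen 19's
`isUnit_compress_op240_smallField`.  Conclusion: `0 < γ₅₆`, `0 ≤ c₅₆`, `B4.Hyp56 Λ′ (reOp Λ (Δ_{k,loc}(u) + (A/a_k)κ′P(u_k))) γ₅₆ c₅₆ δ₀` and
`(…)|_Λ` invertible. [cite: BalabanImbrieJaffe1988, (2.38), (2.40) p.264] [cite: Balaban1983RegularityDecay, (5.6) p.594] -/
theorem hyp56_deltaLocT_gen {k : ℕ} (hk1 : 1 ≤ k) (hk' : 0 + k + 1 ≤ P.m + P.K) {a : ℝ} (ha : 0 < a) (U : GaugeField P 0 U1) {θ : ℝ}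
    (hθ : ∀ (x : Balaban1983to89.Site P 0) (μ ν : Fin P.d), ‖plaqC U x μ ν - 1‖ ≤ θ)
    {Ω : Finset (Balaban1983to89.Site P 0)} (hΩ : IsBlockUnion k Ω) (X₀ : Finset (Balaban1983to89.Site P 0)) {ι : Type*} [Fintype ι]
    {cube : ι → Finset (Balaban1983to89.Site P 0)} (hcube : ∀ α, IsBlockUnion k (cube α)) (Xr : ι → Finset (Balaban1983to89.Site P 0))
    {lam : ι → Balaban1983to89.Site P 0 → Balaban1983to89.Site P 0 → ℝ} {ζ'' : Balaban1983to89.Site P 0 → Balaban1983to89.Site P 0 → ℝ}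
    (hlam : ∀ x y, ∑ α, |lam α x y| ≤ 1) (hlamsymm : ∀ α x₁ x₂, lam α x₂ x₁ = lam α x₁ x₂) (hζ : ∀ x y, 0 ≤ ζ'' x y ∧ ζ'' x y ≤ 1)
    (hζsymm : ∀ x₁ x₂, ζ'' x₂ x₁ = ζ'' x₁ x₂) {δ₀ c₀ : ℝ} (hδ₀ : 0 < δ₀) (hc₀ : 0 ≤ c₀)
    (hGΩ : ∀ x ∈ X₀, ∀ (f : Balaban1983to89.Site P 0 → ℂ) (F D : ℝ), (∀ y, ‖f y‖ ≤ F) → 0 ≤ D →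
      (∀ y, f y ≠ 0 → D ≤ B5Ineq137Torus.T P 0 x y) →
      ‖(gBox (B1RG242Torus.α P a k * (P.L : ℝ) ^ (k * P.d)) P.eps⁻¹ U k Ω *ᵥ f) x‖ ≤
        P.spacing k ^ 2 * (c₀ * Real.exp (-(δ₀ * (((P.L : ℝ) ^ k)⁻¹ * D))) * F))
    (hG : ∀ α, ∀ x ∈ Xr α, ∀ (f : Balaban1983to89.Site P 0 → ℂ) (F D : ℝ), (∀ y, ‖f y‖ ≤ F) → 0 ≤ D →
      (∀ y, f y ≠ 0 → D ≤ B5Ineq137Torus.T P 0 x y) →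
      ‖(gBox (B1RG242Torus.α P a k * (P.L : ℝ) ^ (k * P.d)) P.eps⁻¹ U k (cube α) *ᵥ f) x‖ ≤
        P.spacing k ^ 2 * (c₀ * Real.exp (-(δ₀ * (((P.L : ℝ) ^ k)⁻¹ * D))) * F))
    (hC : ∀ α, ∀ x ∈ Xr α, ∀ (f : Balaban1983to89.Site P 0 → ℂ) (F D Db Df : ℝ), (∀ y, ‖f y‖ ≤ F) → (∀ y, y ∉ cube α → f y = 0) →
      0 ≤ D → (∀ y, f y ≠ 0 → D ≤ B5Ineq137Torus.T P 0 x y) → 0 ≤ Db → (∀ w, w ∉ cube α → Db ≤ B5Ineq137Torus.T P 0 x w) →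
      0 ≤ Df → (∀ y, f y ≠ 0 → ∀ w, w ∉ cube α → Df ≤ B5Ineq137Torus.T P 0 y w) →
      ‖(gBox (B1RG242Torus.α P a k * (P.L : ℝ) ^ (k * P.d)) P.eps⁻¹ U k (cube α) *ᵥ f) x -
          (gBox (B1RG242Torus.α P a k * (P.L : ℝ) ^ (k * P.d)) P.eps⁻¹ U k Ω *ᵥ f) x‖ ≤
        P.spacing k ^ 2 * (c₀ * Real.exp (-(δ₀ * (((P.L : ℝ) ^ k)⁻¹ * D))) * Real.exp (-(δ₀ * (((P.L : ℝ) ^ k)⁻¹ * (Db + Df)))) * F))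
    {R R₁ : ℝ} (hR : 0 ≤ R) (m : ℕ) (Λ : Finset (Balaban1983to89.Site P (0 + k)))
    (hrows : ∀ y₁ ∈ Λ,
      (∀ x ∈ blockK k y₁, x ∈ X₀) ∧
      (∀ x ∈ blockK k y₁, ∀ y, ζ'' x y ≠ 0 → ∑ α, lam α x y = 1) ∧
      (∀ x ∈ blockK k y₁, ∀ α y, ζ'' x y * lam α x y ≠ 0 → x ∈ Xr α ∧ y ∈ cube α ∧
          ∀ w, w ∉ cube α → R ≤ B5Ineq137Torus.T P 0 x w ∧ R ≤ B5Ineq137Torus.T P 0 y w) ∧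
      (∀ x ∈ blockK k y₁, ∀ y, B5Ineq137Torus.T P 0 x y ≤ R₁ → ζ'' x y = 1) ∧
      ∃ S : Finset ι, S.card ≤ m ∧ ∀ x ∈ blockK k y₁, ∀ α y, ζ'' x y * lam α x y ≠ 0 → α ∈ S)
    (hΛ : ∀ b : PBond P (0 + k), (b.src ∈ Λ ∨ b.tgt ∈ Λ) → b ∈ starB (innerK k Ω))
    (hhalfΛ : ∀ y₁ ∈ Λ, ∀ y₂ ∈ Λ, cdist y₁ y₂ ≤ B5Ineq137Torus.T P (0 + k) y₁ y₂)
    {T₁ δ₁ σ : ℝ} (hInt : ∀ b : PBond P (0 + k), blkIter 1 b.src = blkIter 1 b.tgt → ‖toC (lineIter U k b) - 1‖ ≤ T₁)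
    (hTree : ∀ y : Balaban1983to89.Site P (0 + k), ‖holCK (lineIter U k) 1 y - 1‖ ≤ δ₁)
    (hσ : 2 * (((P.L : ℝ) - 1) * P.L) * P.d * T₁ ^ 2 + 2 * δ₁ ^ 2 ≤ σ) {κ' : ℝ} (hκ' : 0 ≤ κ')
    (hE : E56 P a k θ c₀ δ₀ m R R₁ < c240 P (min (a / (9 * ((P.d : ℝ) + 1))) (1 / 12)) κ' * (1 - σ)) :
    0 < gamma56 P a k θ c₀ δ₀ m R R₁ σ κ' ∧ 0 ≤ c56 P a k c₀ δ₀ m κ' ∧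
    B4.Hyp56 (chartSet Λ)
        (reOp Λ (op240 (deltaLocT (B1RG242Torus.α P a k * (P.L : ℝ) ^ (k * P.d)) P.eps⁻¹ U k cube lam ζ'')
          ((B1RG242Torus.α P a k * (P.L : ℝ) ^ (k * P.d)) / B1.aSeq a P.L k * κ') (lineIter U k)))
        (gamma56 P a k θ c₀ δ₀ m R R₁ σ κ') (c56 P a k c₀ δ₀ m κ') δ₀ ∧
      IsUnit (compress Λ (op240 (deltaLocT (B1RG242Torus.α P a k * (P.L : ℝ) ^ (k * P.d)) P.eps⁻¹ U k cube lam ζ'')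
          ((B1RG242Torus.α P a k * (P.L : ℝ) ^ (k * P.d)) / B1.aSeq a P.L k * κ') (lineIter U k))) := by
  have hk : 0 + k ≤ P.m + P.K := (Nat.le_succ _).trans hk'
  set A : ℝ := B1RG242Torus.α P a k * (P.L : ℝ) ^ (k * P.d) with hAdef
  set ak : ℝ := B1.aSeq a P.L k with hakdef
  have hak : 0 < ak := B1.aSeq_pos ha (B1RG242Torus.one_lt_cast_L P) hk1
  have hα : 0 < B1RG242Torus.α P a k := mul_pos hak (inv_pos.mpr (pow_pos (P.spacing_pos k) 2))
  have hA0 : 0 < A := mul_pos hα (pow_pos P.cast_L_pos _)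
  have hAak : 0 < A / ak := div_pos hA0 hak
  set γ₀ : ℝ := min (a / (9 * ((P.d : ℝ) + 1))) (1 / 12) with hγ₀def
  have hγ₀0 : 0 ≤ γ₀ := le_min (by positivity) (by norm_num)
  have hΔ : (deltaLocT A P.eps⁻¹ U k cube lam ζ'').IsHermitian :=
    deltaLocT_conjTranspose hk (inv_ne_zero P.eps_pos.ne') hA0 U hcube hlamsymm hζsymm
  have hγ : 0 ≤ A / ak * γ₀ := mul_nonneg hAak.le hγ₀0
  have hκ : 0 ≤ A / ak * κ' := mul_nonneg hAak.le hκ'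
  have hE' : A / ak * E56 P a k θ c₀ δ₀ m R R₁ < c240 P (A / ak * γ₀) (A / ak * κ') * (1 - σ) := by
    rw [c240_smul P hAak.le, mul_assoc]
    exact mul_lt_mul_of_pos_left hE hAak
  have hgap : c240 P (A / ak * γ₀) (A / ak * κ') * (1 - σ) - A / ak * E56 P a k θ c₀ δ₀ m R R₁ =
      A / ak * (c240 P γ₀ κ' * (1 - σ) - E56 P a k θ c₀ δ₀ m R R₁) := by
    rw [c240_smul P hAak.le]; ring
  -- the (2.38)-shape bound: `ineq238_gen`
  have h238 : ∀ φ : Balaban1983to89.Site P (0 + k) → ℂ, (∀ x ∉ Λ, φ x = 0) →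
      A / ak * γ₀ * ∑ b : PBond P (0 + k), ‖toC (lineIter U k b) * φ b.tgt - φ b.src‖ ^ 2 -
          A / ak * E56 P a k θ c₀ δ₀ m R R₁ * ∑ x, ‖φ x‖ ^ 2 ≤ (star φ ⬝ᵥ (deltaLocT A P.eps⁻¹ U k cube lam ζ'' *ᵥ φ)).re := by
    intro φ hφ
    have h5 := ineq238_gen hk1 hk ha U hθ hΩ X₀ cube Xr hlam hζ hδ₀ hc₀ hGΩ hC hR m (fun ψ => ∀ x ∉ Λ, ψ x = 0)
      (fun ψ hψ y₁ hy₁ => hrows y₁ (by by_contra h; exact hy₁ (hψ y₁ h)))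
      (fun ψ hψ b hb => hΛ b (hb.elim (fun h => Or.inl (by by_contra h'; exact h (hψ _ h')))
        (fun h => Or.inr (by by_contra h'; exact h (hψ _ h'))))) φ hφ
    rw [← hAdef, ← hakdef] at h5
    have e : A / ak * γ₀ * ∑ b : PBond P (0 + k), ‖toC (lineIter U k b) * φ b.tgt - φ b.src‖ ^ 2 -
          A / ak * E56 P a k θ c₀ δ₀ m R R₁ * ∑ x, ‖φ x‖ ^ 2 =
        A / ak * (γ₀ * ∑ b : PBond P (0 + k), ‖toC (lineIter U k b) * φ b.tgt - φ b.src‖ ^ 2 - E56 P a k θ c₀ δ₀ m R R₁ * ∑ x, ‖φ x‖ ^ 2) := by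
      ring
    rw [e]
    exact h5
  -- the (2.36)-shape kernel bound: `decay236_gen`, then chart distance ≤ torus distance on `Λ × Λ`
  set cΔ : ℝ := A * (1 + m * ak * (c₀ * Real.exp δ₀)) with hcΔdef
  have hcΔ : 0 ≤ cΔ := by positivity
  have hker : ∀ y₁ ∈ Λ, ∀ y₂ ∈ Λ, ‖deltaLocT A P.eps⁻¹ U k cube lam ζ'' y₁ y₂‖ ≤ cΔ * Real.exp (-(δ₀ * cdist y₁ y₂)) := by
    intro y₁ hy₁ y₂ hy₂
    obtain ⟨-, -, hdeep, -, S, hSm, hS⟩ := hrows y₁ hy₁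
    have h36 := decay236_gen hk1 hk ha P.eps⁻¹ U cube Xr hlam (fun x y => abs_le.2 ⟨by linarith [(hζ x y).1], (hζ x y).2⟩) hδ₀.le
      hc₀ hG y₁ y₂ (fun x hx α y hαy => (hdeep x hx α y hαy).1) S hS
    rw [← hAdef, ← hakdef] at h36
    have hind : (if y₁ = y₂ then (1 : ℝ) else 0) ≤ Real.exp (-(δ₀ * B5Ineq137Torus.T P (0 + k) y₁ y₂)) := by
      split_ifs with h
      · rw [h, B5Ineq137Torus.T_self, mul_zero, neg_zero, Real.exp_zero]
      · exact Real.exp_nonneg _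
    have hSm' : (S.card : ℝ) ≤ m := by exact_mod_cast hSm
    have hTc : Real.exp (-(δ₀ * B5Ineq137Torus.T P (0 + k) y₁ y₂)) ≤ Real.exp (-(δ₀ * cdist y₁ y₂)) :=
      Real.exp_le_exp.2 (by nlinarith [hhalfΛ y₁ hy₁ y₂ hy₂, hδ₀.le])
    calc ‖deltaLocT A P.eps⁻¹ U k cube lam ζ'' y₁ y₂‖
        ≤ A * ((if y₁ = y₂ then 1 else 0) + S.card * ak * (c₀ * Real.exp δ₀) * Real.exp (-(δ₀ * B5Ineq137Torus.T P (0 + k) y₁ y₂))) := h36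
      _ ≤ A * (Real.exp (-(δ₀ * B5Ineq137Torus.T P (0 + k) y₁ y₂)) +
            m * ak * (c₀ * Real.exp δ₀) * Real.exp (-(δ₀ * B5Ineq137Torus.T P (0 + k) y₁ y₂))) :=
          mul_le_mul_of_nonneg_left (add_le_add hind (mul_le_mul_of_nonneg_right
            (mul_le_mul_of_nonneg_right (mul_le_mul_of_nonneg_right hSm' hak.le) (by positivity)) (Real.exp_nonneg _))) hA0.le
      _ = cΔ * Real.exp (-(δ₀ * B5Ineq137Torus.T P (0 + k) y₁ y₂)) := by rw [hcΔdef]; ring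
      _ ≤ cΔ * Real.exp (-(δ₀ * cdist y₁ y₂)) := mul_le_mul_of_nonneg_left hTc hcΔ
  have h56 := hyp56_op240_smallField (Λ := Λ) (κ := A / ak * κ') hk' (lineIter U k) hInt hTree hσ hΔ hγ hκ h238 hδ₀.le hker
  rw [hgap] at h56
  have hγ56 : 0 < A / ak * (c240 P γ₀ κ' * (1 - σ) - E56 P a k θ c₀ δ₀ m R R₁) := mul_pos hAak (sub_pos.2 hE)
  have hc56 : 0 ≤ cΔ + A / ak * κ' * (((P.L : ℝ) ^ P.d)⁻¹) ^ 2 * Real.exp (δ₀ * ((P.L : ℝ) - 1)) := by positivity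
  exact ⟨hγ56, hc56, h56, isUnit_compress_op240_smallField (Λ := Λ) hk' (lineIter U k) hInt hTree hσ hγ hκ hE' h238⟩

end Gen

/-! ## §4 THE MEMBERS FOR THE PRINTED TORUS DATA: [6] (5.6), (2.42), (2.45), (2.41) (walk route), (2.46), (2.47) for
`C^{(k)}_Λ(u) = [(Δ_{k,loc}(u) + (A/a_k)κ′P(u_k))|_Λ]^{−1}`, `Ω = T_η`, at a general small-plaquette background -/

section TorusData

variable {d : ℕ}

/-- **[6] (5.6) AND (2.40)-INVERTIBILITY FOR THE CONCRETE `C^{(k)}_Λ(u)^{−1} = (Δ_{k,loc}(u) + (A/a_k)κ′P(u_k))|_Λ`, `Ω = T_η`, AT A GENERAL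
SMALL-PLAQUETTE NON-FLAT BACKGROUND, FOR THE PRINTED TORUS DATA** (p. 264: *"by (2.38), C^{(k)}_Λ(u)^{−1} is bounded below and a random walk
expansion as in [6] can be used"*; [6] (5.6): *"A is a bounded, symmetric operator … positive … |A(x,x′)| ≦ c₀e^{−δ₀|x−x′|}"*).  Data: dimension
`d′ = d + 1 ≤ 3`, odd `L = ℓ + 1 ≥ 2`, `a > 0`; `1 ≤ k ≤ K`, `k + 1 ≤ m + K`, `2(L^k − 1) + 4 < |T|`; a `U(1)` field with `‖u(∂p) − 1‖ ≤ θ`,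
`(L^{2k}θ)² ≤ 1/500`; the reference box `Ω₀ = c·L^k + Π_i[0, L^kM₀_i)` (`M₀_i ≥ 1`) AT MOST HALF THE TORUS (`2L^kM₀_i ≤ |T|`, so that the chart
distance of `T^{(k)}` is the torus distance on `Λ`, §1–§2); label spacing `s_g ≥ 1`, half-width `W ≥ 2s_g/3 + R₀/2 + R`, radii `10L^k < R`,
`0 ≤ R₁ < R₀`, torus gap `L^kM₀_i + R ≤ |T|`; `Λ ⊆ T^{(k)}` whose blocks lie in `Ω₀` with chart margin `R₀ + R`; smallness `(T₁, δ′, σ)` of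
`u_k = lineIter u k` in the `L`-blocks; `κ′ ≥ 0`; and `E₅₆ < c240(γ₀, κ′)(1 − σ)` with `m = (⌊(L^k − 1 + R₀)/s_g⌋ + 3)^{d′}`.  Conclusion:
`0 < γ₅₆`, `0 ≤ c₅₆`, **`B4.Hyp56 Λ′ (reOp Λ (Δ_{k,loc}(u) + (A/a_k)κ′P(u_k))) γ₅₆ c₅₆ δ₀`** on the charted `Λ′ ⊂ ℤ^{d′}`, and `(…)|_Λ` is
invertible — §3's `hyp56_deltaLocT_gen` on gen 22's `inputs_smallPlaquette`/`rows_of_deep`.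
[cite: BalabanImbrieJaffe1988, (2.40) p.264] [cite: Balaban1983RegularityDecay, (5.6) p.594] -/
theorem hyp56_deltaLocT_smallPlaquette_torus_cwt (d ℓ : ℕ) (hd1 : 1 ≤ d) (hd3 : d + 1 ≤ 3) (hℓ : 1 ≤ ℓ) (hodd : Odd (ℓ + 1)) {a : ℝ}
    (ha : 0 < a) :
    ∃ δ₀ c₀ : ℝ, 0 < δ₀ ∧ 0 < c₀ ∧ ∀ (P : Params) (hPd : P.d = d + 1), P.L = ℓ + 1 →
      ∀ (k : ℕ), 1 ≤ k → k ≤ P.K → k + 1 ≤ P.m + P.K → 2 * (P.L ^ k - 1) + 4 < P.sitesPerDir 0 →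
      ∀ (U : GaugeField P 0 U1) (θ : ℝ), 0 ≤ θ → (∀ (y : Balaban1983to89.Site P 0) (μ ν : Fin P.d), ‖plaqC U y μ ν - 1‖ ≤ θ) →
        (((P.L : ℝ) ^ k) ^ 2 * θ) ^ 2 ≤ 1 / 500 →
      ∀ (c M0 : Fin (d + 1) → ℕ), (∀ i, 1 ≤ M0 i) → (∀ i, c i * P.L ^ k + P.L ^ k * M0 i ≤ P.sitesPerDir 0) →
        (∀ i, 2 * (P.L ^ k * M0 i) ≤ P.sitesPerDir 0) →
      ∀ (sg W : ℕ), 1 ≤ sg → ∀ (R R₀ R₁ : ℝ), 10 * (P.L : ℝ) ^ k < R → 0 ≤ R₁ → R₁ < R₀ →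
        2 * (sg : ℝ) / 3 + R₀ / 2 + R ≤ W → (∀ i, ((P.L ^ k * M0 i : ℕ) : ℝ) + R ≤ P.sitesPerDir 0) →
      ∀ (Λ : Finset (Balaban1983to89.Site P (0 + k))),
        (∀ y₁ ∈ Λ, ∀ μ, (c (Fin.cast hPd μ) : ℝ) * P.L ^ k + (R₀ + R) ≤ (P.L : ℝ) ^ k * (y₁ μ).val ∧
          (P.L : ℝ) ^ k * (y₁ μ).val + P.L ^ k + (R₀ + R) ≤ (c (Fin.cast hPd μ) : ℝ) * P.L ^ k + (P.L : ℝ) ^ k * M0 (Fin.cast hPd μ)) →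
      ∀ (T₁ δ' σ : ℝ),
        (∀ b : PBond P (0 + k), blkIter 1 b.src = blkIter 1 b.tgt → ‖toC (lineIter U k b) - 1‖ ≤ T₁) →
        (∀ y : Balaban1983to89.Site P (0 + k), ‖holCK (lineIter U k) 1 y - 1‖ ≤ δ') →
        2 * (((P.L : ℝ) - 1) * P.L) * P.d * T₁ ^ 2 + 2 * δ' ^ 2 ≤ σ →
      ∀ (κ' : ℝ), 0 ≤ κ' →
        4 / 3 * (P.d : ℝ) ^ 4 * (((P.L : ℝ) ^ k) ^ 2 * θ) ^ 2 +
            B1.aSeq a P.L k ^ 2 * (c₀ * Real.exp (δ₀ / 2) * latticeConst P.d (δ₀ / 2)) *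
              (((⌊(((P.L : ℝ) ^ k) - 1 + R₀) / sg⌋₊ : ℝ) + 3) ^ (d + 1) *
                  Real.exp (-(δ₀ * (((P.L : ℝ) ^ k)⁻¹ * (2 * R)))) +
                Real.exp (-(δ₀ / 2 * (((P.L : ℝ) ^ k)⁻¹ * R₁)))) <
          c240 P (min (a / (9 * (P.d + 1))) (1 / 12)) κ' * (1 - σ) →
      0 < gamma56 P a k θ c₀ δ₀ ((⌊(((P.L : ℝ) ^ k) - 1 + R₀) / sg⌋₊ + 3) ^ (d + 1)) R R₁ σ κ' ∧
      0 ≤ c56 P a k c₀ δ₀ ((⌊(((P.L : ℝ) ^ k) - 1 + R₀) / sg⌋₊ + 3) ^ (d + 1)) κ' ∧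
      B4.Hyp56 (chartSet Λ)
          (reOp Λ (op240
            (deltaLocT (B1RG242Torus.α P a k * (P.L : ℝ) ^ (k * P.d)) P.eps⁻¹ U k (cubeFam hPd (P.L ^ k) c M0 sg W) (lamFam hPd (P.L ^ k) c M0 sg)
              (cutoff R₁ R₀ (B5Ineq137Torus.T P 0)))
            ((B1RG242Torus.α P a k * (P.L : ℝ) ^ (k * P.d)) / B1.aSeq a P.L k * κ') (lineIter U k)))
          (gamma56 P a k θ c₀ δ₀ ((⌊(((P.L : ℝ) ^ k) - 1 + R₀) / sg⌋₊ + 3) ^ (d + 1)) R R₁ σ κ') (c56 P a k c₀ δ₀ ((⌊(((P.L : ℝ) ^ k) - 1 + R₀) / sg⌋₊ + 3) ^ (d + 1)) κ') δ₀ ∧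
      IsUnit (compress Λ (op240
            (deltaLocT (B1RG242Torus.α P a k * (P.L : ℝ) ^ (k * P.d)) P.eps⁻¹ U k (cubeFam hPd (P.L ^ k) c M0 sg W) (lamFam hPd (P.L ^ k) c M0 sg)
              (cutoff R₁ R₀ (B5Ineq137Torus.T P 0)))
            ((B1RG242Torus.α P a k * (P.L : ℝ) ^ (k * P.d)) / B1.aSeq a P.L k * κ') (lineIter U k))) := by
  obtain ⟨δ₀, c₀, hδ₀, hc₀, I⟩ := inputs_smallPlaquette d ℓ hd1 hd3 hℓ hodd ha
  refine ⟨δ₀, c₀, hδ₀, hc₀, ?_⟩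
  intro P hPd hPL k hk1 hkK hk' hbig U θ hθ0 hθ hτ c M0 hM0 hfit0 hhalf sg W hsg R R₀ R₁ hRm hR₁ hR10 hW hgap Λ hΛ T₁ δ' σ hInt hTree hσ κ' hκ' hE
  have hN0 : ∀ i, P.L ^ k * M0 i < P.sitesPerDir 0 := fun i => by
    have h1 : 0 < P.L ^ k * M0 i := Nat.mul_pos (pow_pos P.L_pos k) (hM0 i)
    have h2 := hhalf i
    omega
  obtain ⟨I1, I2, I3⟩ := I P hPd hPL hk1 hkK hbig U hθ0 hθ hτ hM0 hfit0 hN0 sg W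
  have hkm : k ≤ P.m + P.K := hkK.trans (Nat.le_add_left _ _)
  have hk : 0 + k ≤ P.m + P.K := by omega
  have hn : 1 ≤ P.L ^ k := Nat.one_le_pow _ _ P.L_pos
  have hPk : (0 : ℝ) < (P.L : ℝ) ^ k := pow_pos P.cast_L_pos k
  have hR : 0 ≤ R := le_trans (by positivity) hRm.le
  have hR₀ : 0 ≤ R₀ := hR₁.trans hR10.le
  have hk'' : 0 + k + 1 ≤ P.m + P.K := by omega
  have hcubeBU : ∀ α : ↥(BIJ88LocWeights227Torus.labels (P.L ^ k) M0 sg), IsBlockUnion k (cubeFam hPd (P.L ^ k) c M0 sg W α) := fun α => by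
    obtain ⟨c', M, hM, hfit', -, e⟩ := cubeFam_fits (hPd := hPd) (s := sg) (W := W) hM0 hfit0 hN0 α
    rw [e]; exact isBlockUnion_cubeT hPd hkm rfl hfit'
  have hhalfΛ : ∀ y₁ ∈ Λ, ∀ y₂ ∈ Λ, cdist y₁ y₂ ≤ B5Ineq137Torus.T P (0 + k) y₁ y₂ := fun y₁ hy₁ y₂ hy₂ =>
    cdist_le_T_of_two_mul_abs_le (two_mul_abs_sub_le_of_deep hPd hk (by linarith : 0 ≤ R₀ + R) hhalf (hΛ y₁ hy₁) (hΛ y₂ hy₂))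
  have h := hyp56_deltaLocT_gen hk1 hk'' ha U hθ (isBlockUnion_univ k) univ (cube := cubeFam hPd (P.L ^ k) c M0 sg W) hcubeBU
    (fun α => deepRows (10 * (P.L : ℝ) ^ k) (cubeFam hPd (P.L ^ k) c M0 sg W α))
    (lam := lamFam hPd (P.L ^ k) c M0 sg) (ζ'' := cutoff R₁ R₀ (B5Ineq137Torus.T P 0))
    (sum_abs_lamT_le_one hfit0) (fun α x₁ x₂ => lamFam_symm hPd (P.L ^ k) c M0 sg α x₁ x₂) (cutoff_mem_unitInterval R₁ R₀)
    (cutoff_T_symm R₁ R₀) hδ₀ hc₀.le I1 I2 I3 hR ((⌊(((P.L : ℝ) ^ k) - 1 + R₀) / sg⌋₊ + 3) ^ (d + 1)) Λ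
    (fun y₁ hy₁ => rows_of_deep hPd hk hn hsg hfit0 hR hR₁ hR10 hRm hgap hW (hΛ y₁ hy₁))
    (fun b _ => by rw [starB_innerK_univ]; exact mem_univ _) hhalfΛ hInt hTree hσ hκ'
    (by simp only [E56]; push_cast at hE ⊢; exact hE)
  exact h

/-- **(2.42) FOR THE CONCRETE `C^{(k)}_Λ(u) = [(Δ_{k,loc}(u) + (A/a_k)κ′P(u_k))|_Λ]^{−1}`, `Ω = T_η`, AT A GENERAL SMALL-PLAQUETTE BACKGROUND, FOR
THE PRINTED TORUS DATA** (*"As in [6], there is a random walk expansion for C^{(k)}_Λ(u), C^{(k)}_Λ(u; x₁, x₂) = Σ_ω C^{(k)}_{Λ,ω}(u, x₁, x₂), (2.42)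
where ω is a walk on a lattice of spacing M"*): with the data of `hyp56_deltaLocT_smallPlaquette_torus_cwt`, for cubes of `M ≥ 5` lattice units,
`M > K_R(γ₅₆, c₅₆, δ₀)`, `M > Θ₁(γ₅₆, c₅₆, δ₀)` ([6]'s constants at `N = 2`), for all `x₁, x₂ ∈ Λ`:
**`C^{(k)}_Λ(u; x₁, x₂) = Σ_ω C^ℂ_ω(x₁, x₂)`**, the sum over ALL walks `ω` on the `M`-cubes of the charted `Λ` converging unconditionally in `ℂ`
(`C^ℂ_ω` = first column of the realified `2×2` block of p13's walk term `latticeCw`) — gen 23's `hasSum_walkTerms_inv`.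
[cite: BalabanImbrieJaffe1988, (2.42) p.264] -/
theorem eq242_smallPlaquette_torus_cwt (d ℓ : ℕ) (hd1 : 1 ≤ d) (hd3 : d + 1 ≤ 3) (hℓ : 1 ≤ ℓ) (hodd : Odd (ℓ + 1)) {a : ℝ} (ha : 0 < a) :
    ∃ δ₀ c₀ : ℝ, 0 < δ₀ ∧ 0 < c₀ ∧ ∀ (P : Params) (hPd : P.d = d + 1), P.L = ℓ + 1 →
      ∀ (k : ℕ), 1 ≤ k → k ≤ P.K → k + 1 ≤ P.m + P.K → 2 * (P.L ^ k - 1) + 4 < P.sitesPerDir 0 →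
      ∀ (U : GaugeField P 0 U1) (θ : ℝ), 0 ≤ θ → (∀ (y : Balaban1983to89.Site P 0) (μ ν : Fin P.d), ‖plaqC U y μ ν - 1‖ ≤ θ) →
        (((P.L : ℝ) ^ k) ^ 2 * θ) ^ 2 ≤ 1 / 500 →
      ∀ (c M0 : Fin (d + 1) → ℕ), (∀ i, 1 ≤ M0 i) → (∀ i, c i * P.L ^ k + P.L ^ k * M0 i ≤ P.sitesPerDir 0) →
        (∀ i, 2 * (P.L ^ k * M0 i) ≤ P.sitesPerDir 0) →
      ∀ (sg W : ℕ), 1 ≤ sg → ∀ (R R₀ R₁ : ℝ), 10 * (P.L : ℝ) ^ k < R → 0 ≤ R₁ → R₁ < R₀ →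
        2 * (sg : ℝ) / 3 + R₀ / 2 + R ≤ W → (∀ i, ((P.L ^ k * M0 i : ℕ) : ℝ) + R ≤ P.sitesPerDir 0) →
      ∀ (Λ : Finset (Balaban1983to89.Site P (0 + k))),
        (∀ y₁ ∈ Λ, ∀ μ, (c (Fin.cast hPd μ) : ℝ) * P.L ^ k + (R₀ + R) ≤ (P.L : ℝ) ^ k * (y₁ μ).val ∧
          (P.L : ℝ) ^ k * (y₁ μ).val + P.L ^ k + (R₀ + R) ≤ (c (Fin.cast hPd μ) : ℝ) * P.L ^ k + (P.L : ℝ) ^ k * M0 (Fin.cast hPd μ)) →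
      ∀ (T₁ δ' σ : ℝ),
        (∀ b : PBond P (0 + k), blkIter 1 b.src = blkIter 1 b.tgt → ‖toC (lineIter U k b) - 1‖ ≤ T₁) →
        (∀ y : Balaban1983to89.Site P (0 + k), ‖holCK (lineIter U k) 1 y - 1‖ ≤ δ') →
        2 * (((P.L : ℝ) - 1) * P.L) * P.d * T₁ ^ 2 + 2 * δ' ^ 2 ≤ σ →
      ∀ (κ' : ℝ), 0 ≤ κ' →
        4 / 3 * (P.d : ℝ) ^ 4 * (((P.L : ℝ) ^ k) ^ 2 * θ) ^ 2 +
            B1.aSeq a P.L k ^ 2 * (c₀ * Real.exp (δ₀ / 2) * latticeConst P.d (δ₀ / 2)) *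
              (((⌊(((P.L : ℝ) ^ k) - 1 + R₀) / sg⌋₊ : ℝ) + 3) ^ (d + 1) *
                  Real.exp (-(δ₀ * (((P.L : ℝ) ^ k)⁻¹ * (2 * R)))) +
                Real.exp (-(δ₀ / 2 * (((P.L : ℝ) ^ k)⁻¹ * R₁)))) <
          c240 P (min (a / (9 * (P.d + 1))) (1 / 12)) κ' * (1 - σ) →
      ∀ (M : ℕ), 5 ≤ M → kR P.d 2 (gamma56 P a k θ c₀ δ₀ ((⌊(((P.L : ℝ) ^ k) - 1 + R₀) / sg⌋₊ + 3) ^ (d + 1)) R R₁ σ κ') (c56 P a k c₀ δ₀ ((⌊(((P.L : ℝ) ^ k) - 1 + R₀) / sg⌋₊ + 3) ^ (d + 1)) κ') δ₀ < M →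
        thetaConst P.d 2 (gamma56 P a k θ c₀ δ₀ ((⌊(((P.L : ℝ) ^ k) - 1 + R₀) / sg⌋₊ + 3) ^ (d + 1)) R R₁ σ κ') (c56 P a k c₀ δ₀ ((⌊(((P.L : ℝ) ^ k) - 1 + R₀) / sg⌋₊ + 3) ^ (d + 1)) κ') δ₀ < M →
      ∀ (x₁ x₂ : ↥Λ),
        HasSum (fun ω : Walk ↥(B4Sect5CubeBounds.labels M (chartSet Λ)) =>
            (⟨latticeCw M (chartSet Λ) 2
                  (reOp Λ (op240
            (deltaLocT (B1RG242Torus.α P a k * (P.L : ℝ) ^ (k * P.d)) P.eps⁻¹ U k (cubeFam hPd (P.L ^ k) c M0 sg W) (lamFam hPd (P.L ^ k) c M0 sg)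
              (cutoff R₁ R₀ (B5Ineq137Torus.T P 0)))
            ((B1RG242Torus.α P a k * (P.L : ℝ) ^ (k * P.d)) / B1.aSeq a P.L k * κ') (lineIter U k))) ω (idxEquiv Λ (x₁, 0)) (idxEquiv Λ (x₂, 0)),
              latticeCw M (chartSet Λ) 2
                  (reOp Λ (op240
            (deltaLocT (B1RG242Torus.α P a k * (P.L : ℝ) ^ (k * P.d)) P.eps⁻¹ U k (cubeFam hPd (P.L ^ k) c M0 sg W) (lamFam hPd (P.L ^ k) c M0 sg)
              (cutoff R₁ R₀ (B5Ineq137Torus.T P 0)))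
            ((B1RG242Torus.α P a k * (P.L : ℝ) ^ (k * P.d)) / B1.aSeq a P.L k * κ') (lineIter U k))) ω (idxEquiv Λ (x₁, 1)) (idxEquiv Λ (x₂, 0))⟩ : ℂ))
          ((compress Λ (op240
            (deltaLocT (B1RG242Torus.α P a k * (P.L : ℝ) ^ (k * P.d)) P.eps⁻¹ U k (cubeFam hPd (P.L ^ k) c M0 sg W) (lamFam hPd (P.L ^ k) c M0 sg)
              (cutoff R₁ R₀ (B5Ineq137Torus.T P 0)))
            ((B1RG242Torus.α P a k * (P.L : ℝ) ^ (k * P.d)) / B1.aSeq a P.L k * κ') (lineIter U k)))⁻¹ x₁ x₂) := by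
  obtain ⟨δ₀, c₀, hδ₀, hc₀, H⟩ := hyp56_deltaLocT_smallPlaquette_torus_cwt d ℓ hd1 hd3 hℓ hodd ha
  refine ⟨δ₀, c₀, hδ₀, hc₀, ?_⟩
  intro P hPd hPL k hk1 hkK hk' hbig U θ hθ0 hθ hτ c M0 hM0 hfit0 hhalf sg W hsg R R₀ R₁ hRm hR₁ hR10 hW hgap Λ hΛ T₁ δ' σ hInt hTree hσ κ' hκ' hE M hM hMR hMθ x₁ x₂
  obtain ⟨hγ, hc, hA, hU⟩ := H P hPd hPL k hk1 hkK hk' hbig U θ hθ0 hθ hτ c M0 hM0 hfit0 hhalf sg W hsg R R₀ R₁ hRm hR₁ hR10 hW hgap Λ hΛ T₁ δ' σ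
    hInt hTree hσ κ' hκ' hE
  exact hasSum_walkTerms_inv hγ hc hδ₀ hA hU hM hMR hMθ x₁ x₂

/-- **(2.45) FOR THE CONCRETE `C^{(k)}_Λ(u)`, FOR THE PRINTED TORUS DATA** (*"C^{(k)}_Λ(u) = C^{(k)}_{Λ,loc}(u) + Σ_X C^{(k)}_{Λ,X}(u), (2.45)"*): with the
data of `eq242_smallPlaquette_torus_cwt`, for every locality radius `ρ` (label units) and `r(e_k)`-cube side `s` (labels), the realified entries of
`C^{(k)}_Λ(u)` (`((x₁,Re),(x₂,Re)) ↦ Re C`, `((x₁,Im),(x₂,Re)) ↦ Im C`) ARE the local part plus the sum over cube regions `X` of the `X`-parts —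
the typed row `BIJ88Sect2Statements.Eq245`, gen 23's `eq245_realify_inv`. [cite: BalabanImbrieJaffe1988, (2.45) p.264] -/
theorem eq245_smallPlaquette_torus_cwt (d ℓ : ℕ) (hd1 : 1 ≤ d) (hd3 : d + 1 ≤ 3) (hℓ : 1 ≤ ℓ) (hodd : Odd (ℓ + 1)) {a : ℝ} (ha : 0 < a) :
    ∃ δ₀ c₀ : ℝ, 0 < δ₀ ∧ 0 < c₀ ∧ ∀ (P : Params) (hPd : P.d = d + 1), P.L = ℓ + 1 →
      ∀ (k : ℕ), 1 ≤ k → k ≤ P.K → k + 1 ≤ P.m + P.K → 2 * (P.L ^ k - 1) + 4 < P.sitesPerDir 0 →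
      ∀ (U : GaugeField P 0 U1) (θ : ℝ), 0 ≤ θ → (∀ (y : Balaban1983to89.Site P 0) (μ ν : Fin P.d), ‖plaqC U y μ ν - 1‖ ≤ θ) →
        (((P.L : ℝ) ^ k) ^ 2 * θ) ^ 2 ≤ 1 / 500 →
      ∀ (c M0 : Fin (d + 1) → ℕ), (∀ i, 1 ≤ M0 i) → (∀ i, c i * P.L ^ k + P.L ^ k * M0 i ≤ P.sitesPerDir 0) →
        (∀ i, 2 * (P.L ^ k * M0 i) ≤ P.sitesPerDir 0) →
      ∀ (sg W : ℕ), 1 ≤ sg → ∀ (R R₀ R₁ : ℝ), 10 * (P.L : ℝ) ^ k < R → 0 ≤ R₁ → R₁ < R₀ →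
        2 * (sg : ℝ) / 3 + R₀ / 2 + R ≤ W → (∀ i, ((P.L ^ k * M0 i : ℕ) : ℝ) + R ≤ P.sitesPerDir 0) →
      ∀ (Λ : Finset (Balaban1983to89.Site P (0 + k))),
        (∀ y₁ ∈ Λ, ∀ μ, (c (Fin.cast hPd μ) : ℝ) * P.L ^ k + (R₀ + R) ≤ (P.L : ℝ) ^ k * (y₁ μ).val ∧
          (P.L : ℝ) ^ k * (y₁ μ).val + P.L ^ k + (R₀ + R) ≤ (c (Fin.cast hPd μ) : ℝ) * P.L ^ k + (P.L : ℝ) ^ k * M0 (Fin.cast hPd μ)) →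
      ∀ (T₁ δ' σ : ℝ),
        (∀ b : PBond P (0 + k), blkIter 1 b.src = blkIter 1 b.tgt → ‖toC (lineIter U k b) - 1‖ ≤ T₁) →
        (∀ y : Balaban1983to89.Site P (0 + k), ‖holCK (lineIter U k) 1 y - 1‖ ≤ δ') →
        2 * (((P.L : ℝ) - 1) * P.L) * P.d * T₁ ^ 2 + 2 * δ' ^ 2 ≤ σ →
      ∀ (κ' : ℝ), 0 ≤ κ' →
        4 / 3 * (P.d : ℝ) ^ 4 * (((P.L : ℝ) ^ k) ^ 2 * θ) ^ 2 +
            B1.aSeq a P.L k ^ 2 * (c₀ * Real.exp (δ₀ / 2) * latticeConst P.d (δ₀ / 2)) *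
              (((⌊(((P.L : ℝ) ^ k) - 1 + R₀) / sg⌋₊ : ℝ) + 3) ^ (d + 1) *
                  Real.exp (-(δ₀ * (((P.L : ℝ) ^ k)⁻¹ * (2 * R)))) +
                Real.exp (-(δ₀ / 2 * (((P.L : ℝ) ^ k)⁻¹ * R₁)))) <
          c240 P (min (a / (9 * (P.d + 1))) (1 / 12)) κ' * (1 - σ) →
      ∀ (M : ℕ), 5 ≤ M → kR P.d 2 (gamma56 P a k θ c₀ δ₀ ((⌊(((P.L : ℝ) ^ k) - 1 + R₀) / sg⌋₊ + 3) ^ (d + 1)) R R₁ σ κ') (c56 P a k c₀ δ₀ ((⌊(((P.L : ℝ) ^ k) - 1 + R₀) / sg⌋₊ + 3) ^ (d + 1)) κ') δ₀ < M →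
        thetaConst P.d 2 (gamma56 P a k θ c₀ δ₀ ((⌊(((P.L : ℝ) ^ k) - 1 + R₀) / sg⌋₊ + 3) ^ (d + 1)) R R₁ σ κ') (c56 P a k c₀ δ₀ ((⌊(((P.L : ℝ) ^ k) - 1 + R₀) / sg⌋₊ + 3) ^ (d + 1)) κ') δ₀ < M →
      ∀ (ρ : ℝ) (s : ℕ),
        BIJ88Sect2Statements.Eq245
          (fun p q : ↥Λ × Fin 2 => realify (compress Λ (op240
            (deltaLocT (B1RG242Torus.α P a k * (P.L : ℝ) ^ (k * P.d)) P.eps⁻¹ U k (cubeFam hPd (P.L ^ k) c M0 sg W) (lamFam hPd (P.L ^ k) c M0 sg)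
              (cutoff R₁ R₀ (B5Ineq137Torus.T P 0)))
            ((B1RG242Torus.α P a k * (P.L : ℝ) ^ (k * P.d)) / B1.aSeq a P.L k * κ') (lineIter U k)))⁻¹ p q)
          (fun p q => cLoc (ldist (N := 2) M) ρ (fun ω y₁ y₂ => latticeCw M (chartSet Λ) 2
              (reOp Λ (op240
            (deltaLocT (B1RG242Torus.α P a k * (P.L : ℝ) ^ (k * P.d)) P.eps⁻¹ U k (cubeFam hPd (P.L ^ k) c M0 sg W) (lamFam hPd (P.L ^ k) c M0 sg)
              (cutoff R₁ R₀ (B5Ineq137Torus.T P 0)))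
            ((B1RG242Torus.α P a k * (P.L : ℝ) ^ (k * P.d)) / B1.aSeq a P.L k * κ') (lineIter U k))) ω y₁ y₂) (idxEquiv Λ p) (idxEquiv Λ q))
          (fun X p q => cX (ldist (N := 2) M) ρ (cubeOf M s) touch (fun ω y₁ y₂ => latticeCw M (chartSet Λ) 2
              (reOp Λ (op240
            (deltaLocT (B1RG242Torus.α P a k * (P.L : ℝ) ^ (k * P.d)) P.eps⁻¹ U k (cubeFam hPd (P.L ^ k) c M0 sg W) (lamFam hPd (P.L ^ k) c M0 sg)
              (cutoff R₁ R₀ (B5Ineq137Torus.T P 0)))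
            ((B1RG242Torus.α P a k * (P.L : ℝ) ^ (k * P.d)) / B1.aSeq a P.L k * κ') (lineIter U k))) ω y₁ y₂) X (idxEquiv Λ p) (idxEquiv Λ q)) := by
  obtain ⟨δ₀, c₀, hδ₀, hc₀, H⟩ := hyp56_deltaLocT_smallPlaquette_torus_cwt d ℓ hd1 hd3 hℓ hodd ha
  refine ⟨δ₀, c₀, hδ₀, hc₀, ?_⟩
  intro P hPd hPL k hk1 hkK hk' hbig U θ hθ0 hθ hτ c M0 hM0 hfit0 hhalf sg W hsg R R₀ R₁ hRm hR₁ hR10 hW hgap Λ hΛ T₁ δ' σ hInt hTree hσ κ' hκ' hE M hM hMR hMθ ρ s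
  obtain ⟨hγ, hc, hA, hU⟩ := H P hPd hPL k hk1 hkK hk' hbig U θ hθ0 hθ hτ c M0 hM0 hfit0 hhalf sg W hsg R R₀ R₁ hRm hR₁ hR10 hW hgap Λ hΛ T₁ δ' σ
    hInt hTree hσ κ' hκ' hE
  exact eq245_realify_inv hγ hc hδ₀ hA hU hM hMR hMθ ρ s

/-- **(2.41) BY THE PRINTED WALK ROUTE FOR THE CONCRETE `C^{(k)}_Λ(u)`, FOR THE PRINTED TORUS DATA** (*"a random walk expansion as in [6] can be used
to prove that |C^{(k)}_Λ(u; x₁, x₂)| ≦ ce^{−c|x₁−x₂|}. (2.41)"*): with the data of `eq242_smallPlaquette_torus_cwt` and `θ_W(γ₅₆, c₅₆, δ₀, M) < 1`,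
for all `x₁, x₂ ∈ Λ`: **`‖C^{(k)}_Λ(u; x₁, x₂)‖ ≤ 2·2^{d′}γ₅₆^{−1}(1 − θ_W)^{−1}e^{δ₀/4}·e^{−(δ₀/8)|x₁−x₂|_T/M}`** in the torus distance of `T^{(k)}` —
gen 23's `norm_inv_apply_le_walk` (gen 22's `decay241_smallPlaquette_torus_cwt` is the finite Combes–Thomas twin).
[cite: BalabanImbrieJaffe1988, (2.41) p.264] -/
theorem decay241_walk_smallPlaquette_torus_cwt (d ℓ : ℕ) (hd1 : 1 ≤ d) (hd3 : d + 1 ≤ 3) (hℓ : 1 ≤ ℓ) (hodd : Odd (ℓ + 1)) {a : ℝ}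
    (ha : 0 < a) :
    ∃ δ₀ c₀ : ℝ, 0 < δ₀ ∧ 0 < c₀ ∧ ∀ (P : Params) (hPd : P.d = d + 1), P.L = ℓ + 1 →
      ∀ (k : ℕ), 1 ≤ k → k ≤ P.K → k + 1 ≤ P.m + P.K → 2 * (P.L ^ k - 1) + 4 < P.sitesPerDir 0 →
      ∀ (U : GaugeField P 0 U1) (θ : ℝ), 0 ≤ θ → (∀ (y : Balaban1983to89.Site P 0) (μ ν : Fin P.d), ‖plaqC U y μ ν - 1‖ ≤ θ) →
        (((P.L : ℝ) ^ k) ^ 2 * θ) ^ 2 ≤ 1 / 500 →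
      ∀ (c M0 : Fin (d + 1) → ℕ), (∀ i, 1 ≤ M0 i) → (∀ i, c i * P.L ^ k + P.L ^ k * M0 i ≤ P.sitesPerDir 0) →
        (∀ i, 2 * (P.L ^ k * M0 i) ≤ P.sitesPerDir 0) →
      ∀ (sg W : ℕ), 1 ≤ sg → ∀ (R R₀ R₁ : ℝ), 10 * (P.L : ℝ) ^ k < R → 0 ≤ R₁ → R₁ < R₀ →
        2 * (sg : ℝ) / 3 + R₀ / 2 + R ≤ W → (∀ i, ((P.L ^ k * M0 i : ℕ) : ℝ) + R ≤ P.sitesPerDir 0) →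
      ∀ (Λ : Finset (Balaban1983to89.Site P (0 + k))),
        (∀ y₁ ∈ Λ, ∀ μ, (c (Fin.cast hPd μ) : ℝ) * P.L ^ k + (R₀ + R) ≤ (P.L : ℝ) ^ k * (y₁ μ).val ∧
          (P.L : ℝ) ^ k * (y₁ μ).val + P.L ^ k + (R₀ + R) ≤ (c (Fin.cast hPd μ) : ℝ) * P.L ^ k + (P.L : ℝ) ^ k * M0 (Fin.cast hPd μ)) →
      ∀ (T₁ δ' σ : ℝ),
        (∀ b : PBond P (0 + k), blkIter 1 b.src = blkIter 1 b.tgt → ‖toC (lineIter U k b) - 1‖ ≤ T₁) →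
        (∀ y : Balaban1983to89.Site P (0 + k), ‖holCK (lineIter U k) 1 y - 1‖ ≤ δ') →
        2 * (((P.L : ℝ) - 1) * P.L) * P.d * T₁ ^ 2 + 2 * δ' ^ 2 ≤ σ →
      ∀ (κ' : ℝ), 0 ≤ κ' →
        4 / 3 * (P.d : ℝ) ^ 4 * (((P.L : ℝ) ^ k) ^ 2 * θ) ^ 2 +
            B1.aSeq a P.L k ^ 2 * (c₀ * Real.exp (δ₀ / 2) * latticeConst P.d (δ₀ / 2)) *
              (((⌊(((P.L : ℝ) ^ k) - 1 + R₀) / sg⌋₊ : ℝ) + 3) ^ (d + 1) *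
                  Real.exp (-(δ₀ * (((P.L : ℝ) ^ k)⁻¹ * (2 * R)))) +
                Real.exp (-(δ₀ / 2 * (((P.L : ℝ) ^ k)⁻¹ * R₁)))) <
          c240 P (min (a / (9 * (P.d + 1))) (1 / 12)) κ' * (1 - σ) →
      ∀ (M : ℕ), 5 ≤ M → kR P.d 2 (gamma56 P a k θ c₀ δ₀ ((⌊(((P.L : ℝ) ^ k) - 1 + R₀) / sg⌋₊ + 3) ^ (d + 1)) R R₁ σ κ') (c56 P a k c₀ δ₀ ((⌊(((P.L : ℝ) ^ k) - 1 + R₀) / sg⌋₊ + 3) ^ (d + 1)) κ') δ₀ < M →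
        thetaConst P.d 2 (gamma56 P a k θ c₀ δ₀ ((⌊(((P.L : ℝ) ^ k) - 1 + R₀) / sg⌋₊ + 3) ^ (d + 1)) R R₁ σ κ') (c56 P a k c₀ δ₀ ((⌊(((P.L : ℝ) ^ k) - 1 + R₀) / sg⌋₊ + 3) ^ (d + 1)) κ') δ₀ < M →
        thetaW P.d 2 (gamma56 P a k θ c₀ δ₀ ((⌊(((P.L : ℝ) ^ k) - 1 + R₀) / sg⌋₊ + 3) ^ (d + 1)) R R₁ σ κ') (c56 P a k c₀ δ₀ ((⌊(((P.L : ℝ) ^ k) - 1 + R₀) / sg⌋₊ + 3) ^ (d + 1)) κ') δ₀ M < 1 →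
      ∀ (x₁ x₂ : ↥Λ),
        ‖(compress Λ (op240
            (deltaLocT (B1RG242Torus.α P a k * (P.L : ℝ) ^ (k * P.d)) P.eps⁻¹ U k (cubeFam hPd (P.L ^ k) c M0 sg W) (lamFam hPd (P.L ^ k) c M0 sg)
              (cutoff R₁ R₀ (B5Ineq137Torus.T P 0)))
            ((B1RG242Torus.α P a k * (P.L : ℝ) ^ (k * P.d)) / B1.aSeq a P.L k * κ') (lineIter U k)))⁻¹ x₁ x₂‖ ≤
          2 * (2 ^ P.d * (gamma56 P a k θ c₀ δ₀ ((⌊(((P.L : ℝ) ^ k) - 1 + R₀) / sg⌋₊ + 3) ^ (d + 1)) R R₁ σ κ')⁻¹ *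
              (1 - thetaW P.d 2 (gamma56 P a k θ c₀ δ₀ ((⌊(((P.L : ℝ) ^ k) - 1 + R₀) / sg⌋₊ + 3) ^ (d + 1)) R R₁ σ κ') (c56 P a k c₀ δ₀ ((⌊(((P.L : ℝ) ^ k) - 1 + R₀) / sg⌋₊ + 3) ^ (d + 1)) κ') δ₀ M)⁻¹ *
              Real.exp (δ₀ / 4)) *
            Real.exp (-(δ₀ / 8) * (B5Ineq137Torus.T P (0 + k) x₁.1 x₂.1 / M)) := by
  obtain ⟨δ₀, c₀, hδ₀, hc₀, H⟩ := hyp56_deltaLocT_smallPlaquette_torus_cwt d ℓ hd1 hd3 hℓ hodd ha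
  refine ⟨δ₀, c₀, hδ₀, hc₀, ?_⟩
  intro P hPd hPL k hk1 hkK hk' hbig U θ hθ0 hθ hτ c M0 hM0 hfit0 hhalf sg W hsg R R₀ R₁ hRm hR₁ hR10 hW hgap Λ hΛ T₁ δ' σ hInt hTree hσ κ' hκ' hE M hM hMR hMθ hθW x₁ x₂
  obtain ⟨hγ, hc, hA, hU⟩ := H P hPd hPL k hk1 hkK hk' hbig U θ hθ0 hθ hτ c M0 hM0 hfit0 hhalf sg W hsg R R₀ R₁ hRm hR₁ hR10 hW hgap Λ hΛ T₁ δ' σ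
    hInt hTree hσ κ' hκ' hE
  exact norm_inv_apply_le_walk hγ hc hδ₀ hA hU hM hMR hMθ hθW x₁ x₂

/-- **(2.46) AS THE TYPED ROW `BIJ88Sect2Statements.Ineq246` FOR THE CONCRETE `C^{(k)}_Λ(u)`, FOR THE PRINTED TORUS DATA** (*"It vanishes unless both
arguments are in X, and is estimated as follows: |C^{(k)}_{Λ,X}(u; x₁, x₂)| ≦ e^{−cr(e_k)|X|}. (2.46) Here and elsewhere, |X| refers to the number of
r(e_k)-cubes in X"*): with the data of `decay241_walk_smallPlaquette_torus_cwt`, `r(e_k)`-cubes of `s ≥ 1` labels, `ρ = s/4`, and `r(e_k)` large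
enough that `K₀(γ₅₆, c₅₆, δ₀, M) ≤ e^{(δ₀/(128·9^{d′}))s}`: the `X`-parts of the realified `C^{(k)}_Λ(u)` vanish unless both arguments lie in `X` and obey
`|C_{Λ,X}| ≤ e^{−c·s·|X|}`, `c = δ₀/(128·9^{d′})` — gen 23's `ineq246_walk`. [cite: BalabanImbrieJaffe1988, (2.46) p.264] -/
theorem ineq246_smallPlaquette_torus_cwt (d ℓ : ℕ) (hd1 : 1 ≤ d) (hd3 : d + 1 ≤ 3) (hℓ : 1 ≤ ℓ) (hodd : Odd (ℓ + 1)) {a : ℝ} (ha : 0 < a) :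
    ∃ δ₀ c₀ : ℝ, 0 < δ₀ ∧ 0 < c₀ ∧ ∀ (P : Params) (hPd : P.d = d + 1), P.L = ℓ + 1 →
      ∀ (k : ℕ), 1 ≤ k → k ≤ P.K → k + 1 ≤ P.m + P.K → 2 * (P.L ^ k - 1) + 4 < P.sitesPerDir 0 →
      ∀ (U : GaugeField P 0 U1) (θ : ℝ), 0 ≤ θ → (∀ (y : Balaban1983to89.Site P 0) (μ ν : Fin P.d), ‖plaqC U y μ ν - 1‖ ≤ θ) →
        (((P.L : ℝ) ^ k) ^ 2 * θ) ^ 2 ≤ 1 / 500 →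
      ∀ (c M0 : Fin (d + 1) → ℕ), (∀ i, 1 ≤ M0 i) → (∀ i, c i * P.L ^ k + P.L ^ k * M0 i ≤ P.sitesPerDir 0) →
        (∀ i, 2 * (P.L ^ k * M0 i) ≤ P.sitesPerDir 0) →
      ∀ (sg W : ℕ), 1 ≤ sg → ∀ (R R₀ R₁ : ℝ), 10 * (P.L : ℝ) ^ k < R → 0 ≤ R₁ → R₁ < R₀ →
        2 * (sg : ℝ) / 3 + R₀ / 2 + R ≤ W → (∀ i, ((P.L ^ k * M0 i : ℕ) : ℝ) + R ≤ P.sitesPerDir 0) →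
      ∀ (Λ : Finset (Balaban1983to89.Site P (0 + k))),
        (∀ y₁ ∈ Λ, ∀ μ, (c (Fin.cast hPd μ) : ℝ) * P.L ^ k + (R₀ + R) ≤ (P.L : ℝ) ^ k * (y₁ μ).val ∧
          (P.L : ℝ) ^ k * (y₁ μ).val + P.L ^ k + (R₀ + R) ≤ (c (Fin.cast hPd μ) : ℝ) * P.L ^ k + (P.L : ℝ) ^ k * M0 (Fin.cast hPd μ)) →
      ∀ (T₁ δ' σ : ℝ),
        (∀ b : PBond P (0 + k), blkIter 1 b.src = blkIter 1 b.tgt → ‖toC (lineIter U k b) - 1‖ ≤ T₁) →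
        (∀ y : Balaban1983to89.Site P (0 + k), ‖holCK (lineIter U k) 1 y - 1‖ ≤ δ') →
        2 * (((P.L : ℝ) - 1) * P.L) * P.d * T₁ ^ 2 + 2 * δ' ^ 2 ≤ σ →
      ∀ (κ' : ℝ), 0 ≤ κ' →
        4 / 3 * (P.d : ℝ) ^ 4 * (((P.L : ℝ) ^ k) ^ 2 * θ) ^ 2 +
            B1.aSeq a P.L k ^ 2 * (c₀ * Real.exp (δ₀ / 2) * latticeConst P.d (δ₀ / 2)) *
              (((⌊(((P.L : ℝ) ^ k) - 1 + R₀) / sg⌋₊ : ℝ) + 3) ^ (d + 1) *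
                  Real.exp (-(δ₀ * (((P.L : ℝ) ^ k)⁻¹ * (2 * R)))) +
                Real.exp (-(δ₀ / 2 * (((P.L : ℝ) ^ k)⁻¹ * R₁)))) <
          c240 P (min (a / (9 * (P.d + 1))) (1 / 12)) κ' * (1 - σ) →
      ∀ (M : ℕ), 5 ≤ M → kR P.d 2 (gamma56 P a k θ c₀ δ₀ ((⌊(((P.L : ℝ) ^ k) - 1 + R₀) / sg⌋₊ + 3) ^ (d + 1)) R R₁ σ κ') (c56 P a k c₀ δ₀ ((⌊(((P.L : ℝ) ^ k) - 1 + R₀) / sg⌋₊ + 3) ^ (d + 1)) κ') δ₀ < M →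
        thetaConst P.d 2 (gamma56 P a k θ c₀ δ₀ ((⌊(((P.L : ℝ) ^ k) - 1 + R₀) / sg⌋₊ + 3) ^ (d + 1)) R R₁ σ κ') (c56 P a k c₀ δ₀ ((⌊(((P.L : ℝ) ^ k) - 1 + R₀) / sg⌋₊ + 3) ^ (d + 1)) κ') δ₀ < M →
        thetaW P.d 2 (gamma56 P a k θ c₀ δ₀ ((⌊(((P.L : ℝ) ^ k) - 1 + R₀) / sg⌋₊ + 3) ^ (d + 1)) R R₁ σ κ') (c56 P a k c₀ δ₀ ((⌊(((P.L : ℝ) ^ k) - 1 + R₀) / sg⌋₊ + 3) ^ (d + 1)) κ') δ₀ M < 1 →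
      ∀ (s : ℕ), 0 < s →
        K0 P.d 2 (gamma56 P a k θ c₀ δ₀ ((⌊(((P.L : ℝ) ^ k) - 1 + R₀) / sg⌋₊ + 3) ^ (d + 1)) R R₁ σ κ') (c56 P a k c₀ δ₀ ((⌊(((P.L : ℝ) ^ k) - 1 + R₀) / sg⌋₊ + 3) ^ (d + 1)) κ') δ₀ M ≤
          Real.exp (δ₀ / (128 * 9 ^ P.d) * s) →
        BIJ88Sect2Statements.Ineq246 (fun X : Finset (Cubes M s (chartSet Λ)) => X.card)
          (fun (p : ↥Λ × Fin 2) (X : Finset (Cubes M s (chartSet Λ))) =>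
            memX (fun (x : B4.Idx (chartSet Λ) 2) (l : ↥(B4Sect5CubeBounds.labels M (chartSet Λ))) =>
              B4Sect5CubeBounds.InBox M l.1 (x.1 : Fin P.d → ℤ)) (cubeOf M s) touch (idxEquiv Λ p) X)
          (fun X p q => cX (ldist (N := 2) M) ((s : ℝ) / 4) (cubeOf M s) touch (fun ω y₁ y₂ => latticeCw M (chartSet Λ) 2
              (reOp Λ (op240
            (deltaLocT (B1RG242Torus.α P a k * (P.L : ℝ) ^ (k * P.d)) P.eps⁻¹ U k (cubeFam hPd (P.L ^ k) c M0 sg W) (lamFam hPd (P.L ^ k) c M0 sg)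
              (cutoff R₁ R₀ (B5Ineq137Torus.T P 0)))
            ((B1RG242Torus.α P a k * (P.L : ℝ) ^ (k * P.d)) / B1.aSeq a P.L k * κ') (lineIter U k))) ω y₁ y₂) X (idxEquiv Λ p) (idxEquiv Λ q))
          (δ₀ / (128 * 9 ^ P.d)) s := by
  obtain ⟨δ₀, c₀, hδ₀, hc₀, H⟩ := hyp56_deltaLocT_smallPlaquette_torus_cwt d ℓ hd1 hd3 hℓ hodd ha
  refine ⟨δ₀, c₀, hδ₀, hc₀, ?_⟩
  intro P hPd hPL k hk1 hkK hk' hbig U θ hθ0 hθ hτ c M0 hM0 hfit0 hhalf sg W hsg R R₀ R₁ hRm hR₁ hR10 hW hgap Λ hΛ T₁ δ' σ hInt hTree hσ κ' hκ' hE M hM hMR hMθ hθW s hs hlarge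
  obtain ⟨hγ, hc, hA, -⟩ := H P hPd hPL k hk1 hkK hk' hbig U θ hθ0 hθ hτ c M0 hM0 hfit0 hhalf sg W hsg R R₀ R₁ hRm hR₁ hR10 hW hgap Λ hΛ T₁ δ' σ
    hInt hTree hσ κ' hκ' hE
  exact ineq246_walk hγ hc hδ₀ hA hM hMR hMθ hθW hs hlarge

/-- **(2.47) AS THE TYPED ROW `BIJ88Sect2Statements.Close` FOR THE CONCRETE `C^{(k)}_Λ(u)`, IN THE TORUS DISTANCE, FOR THE PRINTED TORUS DATA**
(*"This estimate can be summed over all connected sets X to show that |C^{(k)}_{Λ,loc}(u; x₁, x₂) − C^{(k)}_Λ(u; x₁, x₂)| ≦ e^{−cr(e_k)}e^{−c|x₁−x₂|}.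
(2.47)"*): with the data of `decay241_walk_smallPlaquette_torus_cwt` and every locality radius `ρ`:
`Close (|x₁−x₂|_T/M) C_{Λ,loc} (realify C^{(k)}_Λ(u)) (2^{d′}γ₅₆^{−1}(1−θ_W)^{−1}e^{−(δ₀/16)(ρ−3)}) (δ₀/16)` on `Λ × {Re, Im}` — gen 23's `close247_walk`,
the chart distance being the torus distance on `Λ` (half-torus box, §1–§2). [cite: BalabanImbrieJaffe1988, (2.47) p.265] -/
theorem close247_smallPlaquette_torus_cwt (d ℓ : ℕ) (hd1 : 1 ≤ d) (hd3 : d + 1 ≤ 3) (hℓ : 1 ≤ ℓ) (hodd : Odd (ℓ + 1)) {a : ℝ} (ha : 0 < a) :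
    ∃ δ₀ c₀ : ℝ, 0 < δ₀ ∧ 0 < c₀ ∧ ∀ (P : Params) (hPd : P.d = d + 1), P.L = ℓ + 1 →
      ∀ (k : ℕ), 1 ≤ k → k ≤ P.K → k + 1 ≤ P.m + P.K → 2 * (P.L ^ k - 1) + 4 < P.sitesPerDir 0 →
      ∀ (U : GaugeField P 0 U1) (θ : ℝ), 0 ≤ θ → (∀ (y : Balaban1983to89.Site P 0) (μ ν : Fin P.d), ‖plaqC U y μ ν - 1‖ ≤ θ) →
        (((P.L : ℝ) ^ k) ^ 2 * θ) ^ 2 ≤ 1 / 500 →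
      ∀ (c M0 : Fin (d + 1) → ℕ), (∀ i, 1 ≤ M0 i) → (∀ i, c i * P.L ^ k + P.L ^ k * M0 i ≤ P.sitesPerDir 0) →
        (∀ i, 2 * (P.L ^ k * M0 i) ≤ P.sitesPerDir 0) →
      ∀ (sg W : ℕ), 1 ≤ sg → ∀ (R R₀ R₁ : ℝ), 10 * (P.L : ℝ) ^ k < R → 0 ≤ R₁ → R₁ < R₀ →
        2 * (sg : ℝ) / 3 + R₀ / 2 + R ≤ W → (∀ i, ((P.L ^ k * M0 i : ℕ) : ℝ) + R ≤ P.sitesPerDir 0) →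
      ∀ (Λ : Finset (Balaban1983to89.Site P (0 + k))),
        (∀ y₁ ∈ Λ, ∀ μ, (c (Fin.cast hPd μ) : ℝ) * P.L ^ k + (R₀ + R) ≤ (P.L : ℝ) ^ k * (y₁ μ).val ∧
          (P.L : ℝ) ^ k * (y₁ μ).val + P.L ^ k + (R₀ + R) ≤ (c (Fin.cast hPd μ) : ℝ) * P.L ^ k + (P.L : ℝ) ^ k * M0 (Fin.cast hPd μ)) →
      ∀ (T₁ δ' σ : ℝ),
        (∀ b : PBond P (0 + k), blkIter 1 b.src = blkIter 1 b.tgt → ‖toC (lineIter U k b) - 1‖ ≤ T₁) →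
        (∀ y : Balaban1983to89.Site P (0 + k), ‖holCK (lineIter U k) 1 y - 1‖ ≤ δ') →
        2 * (((P.L : ℝ) - 1) * P.L) * P.d * T₁ ^ 2 + 2 * δ' ^ 2 ≤ σ →
      ∀ (κ' : ℝ), 0 ≤ κ' →
        4 / 3 * (P.d : ℝ) ^ 4 * (((P.L : ℝ) ^ k) ^ 2 * θ) ^ 2 +
            B1.aSeq a P.L k ^ 2 * (c₀ * Real.exp (δ₀ / 2) * latticeConst P.d (δ₀ / 2)) *
              (((⌊(((P.L : ℝ) ^ k) - 1 + R₀) / sg⌋₊ : ℝ) + 3) ^ (d + 1) *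
                  Real.exp (-(δ₀ * (((P.L : ℝ) ^ k)⁻¹ * (2 * R)))) +
                Real.exp (-(δ₀ / 2 * (((P.L : ℝ) ^ k)⁻¹ * R₁)))) <
          c240 P (min (a / (9 * (P.d + 1))) (1 / 12)) κ' * (1 - σ) →
      ∀ (M : ℕ), 5 ≤ M → kR P.d 2 (gamma56 P a k θ c₀ δ₀ ((⌊(((P.L : ℝ) ^ k) - 1 + R₀) / sg⌋₊ + 3) ^ (d + 1)) R R₁ σ κ') (c56 P a k c₀ δ₀ ((⌊(((P.L : ℝ) ^ k) - 1 + R₀) / sg⌋₊ + 3) ^ (d + 1)) κ') δ₀ < M →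
        thetaConst P.d 2 (gamma56 P a k θ c₀ δ₀ ((⌊(((P.L : ℝ) ^ k) - 1 + R₀) / sg⌋₊ + 3) ^ (d + 1)) R R₁ σ κ') (c56 P a k c₀ δ₀ ((⌊(((P.L : ℝ) ^ k) - 1 + R₀) / sg⌋₊ + 3) ^ (d + 1)) κ') δ₀ < M →
        thetaW P.d 2 (gamma56 P a k θ c₀ δ₀ ((⌊(((P.L : ℝ) ^ k) - 1 + R₀) / sg⌋₊ + 3) ^ (d + 1)) R R₁ σ κ') (c56 P a k c₀ δ₀ ((⌊(((P.L : ℝ) ^ k) - 1 + R₀) / sg⌋₊ + 3) ^ (d + 1)) κ') δ₀ M < 1 →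
      ∀ (ρ : ℝ),
        BIJ88Sect2Statements.Close (fun p q : ↥Λ × Fin 2 => B5Ineq137Torus.T P (0 + k) p.1.1 q.1.1 / M)
          (fun p q => cLoc (ldist (N := 2) M) ρ (fun ω y₁ y₂ => latticeCw M (chartSet Λ) 2
              (reOp Λ (op240
            (deltaLocT (B1RG242Torus.α P a k * (P.L : ℝ) ^ (k * P.d)) P.eps⁻¹ U k (cubeFam hPd (P.L ^ k) c M0 sg W) (lamFam hPd (P.L ^ k) c M0 sg)
              (cutoff R₁ R₀ (B5Ineq137Torus.T P 0)))
            ((B1RG242Torus.α P a k * (P.L : ℝ) ^ (k * P.d)) / B1.aSeq a P.L k * κ') (lineIter U k))) ω y₁ y₂) (idxEquiv Λ p) (idxEquiv Λ q))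
          (fun p q => realify (compress Λ (op240
            (deltaLocT (B1RG242Torus.α P a k * (P.L : ℝ) ^ (k * P.d)) P.eps⁻¹ U k (cubeFam hPd (P.L ^ k) c M0 sg W) (lamFam hPd (P.L ^ k) c M0 sg)
              (cutoff R₁ R₀ (B5Ineq137Torus.T P 0)))
            ((B1RG242Torus.α P a k * (P.L : ℝ) ^ (k * P.d)) / B1.aSeq a P.L k * κ') (lineIter U k)))⁻¹ p q)
          (2 ^ P.d * (gamma56 P a k θ c₀ δ₀ ((⌊(((P.L : ℝ) ^ k) - 1 + R₀) / sg⌋₊ + 3) ^ (d + 1)) R R₁ σ κ')⁻¹ *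
              (1 - thetaW P.d 2 (gamma56 P a k θ c₀ δ₀ ((⌊(((P.L : ℝ) ^ k) - 1 + R₀) / sg⌋₊ + 3) ^ (d + 1)) R R₁ σ κ') (c56 P a k c₀ δ₀ ((⌊(((P.L : ℝ) ^ k) - 1 + R₀) / sg⌋₊ + 3) ^ (d + 1)) κ') δ₀ M)⁻¹ *
            Real.exp (-(δ₀ / 16 * (ρ - 3)))) (δ₀ / 16) := by
  obtain ⟨δ₀, c₀, hδ₀, hc₀, H⟩ := hyp56_deltaLocT_smallPlaquette_torus_cwt d ℓ hd1 hd3 hℓ hodd ha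
  refine ⟨δ₀, c₀, hδ₀, hc₀, ?_⟩
  intro P hPd hPL k hk1 hkK hk' hbig U θ hθ0 hθ hτ c M0 hM0 hfit0 hhalf sg W hsg R R₀ R₁ hRm hR₁ hR10 hW hgap Λ hΛ T₁ δ' σ hInt hTree hσ κ' hκ' hE M hM hMR hMθ hθW ρ p q
  obtain ⟨hγ, hc, hA, hU⟩ := H P hPd hPL k hk1 hkK hk' hbig U θ hθ0 hθ hτ c M0 hM0 hfit0 hhalf sg W hsg R R₀ R₁ hRm hR₁ hR10 hW hgap Λ hΛ T₁ δ' σ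
    hInt hTree hσ κ' hκ' hE
  have hk : 0 + k ≤ P.m + P.K := by omega
  have hPk : (0 : ℝ) < (P.L : ℝ) ^ k := pow_pos P.cast_L_pos k
  have hR : 0 ≤ R := le_trans (by positivity) hRm.le
  have hR₀ : 0 ≤ R₀ := hR₁.trans hR10.le
  have h := close247_walk hγ hc hδ₀ hA hU hM hMR hMθ hθW ρ p q
  dsimp only at h ⊢
  rwa [cdist_eq_T_of_two_mul_abs_le (two_mul_abs_sub_le_of_deep hPd hk (by linarith : 0 ≤ R₀ + R) hhalf (hΛ p.1.1 p.1.2)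
    (hΛ q.1.1 q.1.2))] at h

end TorusData

end

end Literature.MathematicalPhysics.QuantumFieldTheory.BalabanImbrieJaffe1984to88.BIJ88Eq242HiggsCovarianceTorusCwt
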